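import Summits.HodgeConjecture.HodgeConjecture.Theorems.SignSymmetricPowersNodalFormsTools

/-!
# K1-B nodal forms (route `SignSymmetricPowers`, item stmt-HodgeConjecture-19716) — the Π-node witness

Helper file for the registered stub `stub_signNodalForms` (K1-B line `andre-zariski` v9/v10, WANTED
P3-W8; first conjunct): for every even `d = m + 4 ≥ 4` an explicit ι-even quinary form of degree `d` whose
projective hypersurface has exactly ONE singular point, an ordinary double point at
`e₄ = [0:0:0:0:1] ∈ Π = {x₀ = x₁ = 0}`. Landed `--supports stmt-HodgeConjecture-19716` as a helper; the
stub itself is assembled in `SignSymmetricPowersNodalForms.lean`. Sorry-free; axioms standard.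

## The witness (a SPLIT variant of the blueprint `memos/K1B-NODAL-FORMS-g22.md` §(Π))

`f = x₄^{m+2} (x₀ x₁ + x₂ x₃) + x₀^{m+4} + x₁^{m+4} + x₂^{m+4} + 2 x₃^{m+4}`.

* ι-even (`x₀x₁` has degree `2` in `x₀, x₁`, the pure powers have even degree): checked as invariance
  under `(x₀, x₁) ↦ (-x₀, -x₁)` (`coeff_eq_zero_of_sign_aeval_eq`).
* gradient (`pderiv_planeForm`): `∂₀f = x₄^{m+2} x₁ + (m+4) x₀^{m+3}`, `∂₁f = x₄^{m+2} x₀ + (m+4) x₁^{m+3}`,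
  `∂₂f = x₄^{m+2} x₃ + (m+4) x₂^{m+3}`, `∂₃f = x₄^{m+2} x₂ + 2(m+4) x₃^{m+3}`,
  `∂₄f = (m+2) x₄^{m+1} (x₀x₁ + x₂x₃)`; all vanish at `e₄`.
* Hessian at `e₄`: the permutation-type matrix `x₀ ↔ x₁`, `x₂ ↔ x₃` with a zero row/column for `x₄`;
  rank `4` (`rank_eq_four`: its square is `diag(1,1,1,1,0)`, its kernel contains `e₄`).
* ONLY singular point — purely algebraically (no estimates, unlike the blueprint's Fermat-type
  perturbation): if `z₄ = 0` the gradient equations give `z = 0`; if `z₄ ≠ 0` then `z₀z₁ + z₂z₃ = 0` (from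
  `∂₄f`) and the four remaining equations are the split system of `split_pair_eq_zero` with
  `w = z₄^{m+2}`, coefficient products `1 · 1 ≠ 1 · 2`, whence `z₀ = z₁ = z₂ = z₃ = 0`, `z = z₄ • e₄`.
-/

set_option linter.dupNamespace false

noncomputable section

namespace Summit.HodgeConjecture.HodgeConjecture.Theorems.SignSymmetricPowersNodalFormPlane

open MvPolynomial Literature.AlgebraicGeometry.Motives Literature.AlgebraicGeometry.HodgeTheory
open Summit.HodgeConjecture.HodgeConjecture.Theorems.SignSymmetricPowersNodalFormsTools

/-- The gradient of the Π-witness `x₄^{m+2}(x₀x₁ + x₂x₃) + x₀^{m+4} + x₁^{m+4} + x₂^{m+4} + 2x₃^{m+4}`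
(closed form of the five partial derivatives). -/
theorem pderiv_planeForm (m : ℕ) :
    let f : MvPolynomial (Fin 5) ℂ := X 4 ^ (m + 2) * (X 0 * X 1 + X 2 * X 3) + X 0 ^ (m + 4) +
      X 1 ^ (m + 4) + X 2 ^ (m + 4) + C 2 * X 3 ^ (m + 4)
    pderiv 0 f = X 4 ^ (m + 2) * X 1 + C ((m : ℂ) + 4) * X 0 ^ (m + 3) ∧
    pderiv 1 f = X 4 ^ (m + 2) * X 0 + C ((m : ℂ) + 4) * X 1 ^ (m + 3) ∧
    pderiv 2 f = X 4 ^ (m + 2) * X 3 + C ((m : ℂ) + 4) * X 2 ^ (m + 3) ∧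
    pderiv 3 f = X 4 ^ (m + 2) * X 2 + C (2 * ((m : ℂ) + 4)) * X 3 ^ (m + 3) ∧
    pderiv 4 f = C ((m : ℂ) + 2) * X 4 ^ (m + 1) * (X 0 * X 1 + X 2 * X 3) := by
  intro f
  refine ⟨?_, ?_, ?_, ?_, ?_⟩ <;>
  · simp +decide only [f, map_add, Derivation.leibniz, Derivation.leibniz_pow, pderiv_X, pderiv_C,
      Pi.single_apply, smul_eq_mul, mul_zero, add_zero, Nat.add_succ_sub_one, if_true, if_false,
      nsmul_eq_mul, Nat.cast_add, Nat.cast_ofNat]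
    simp only [map_add, map_mul, map_natCast, map_ofNat]
    ring


/-- The gradient of the Π-witness as a vector of closed forms. -/
theorem pderiv_planeForm_eq (m : ℕ) (j : Fin 5) :
    pderiv j (X 4 ^ (m + 2) * (X 0 * X 1 + X 2 * X 3) + X 0 ^ (m + 4) + X 1 ^ (m + 4) + X 2 ^ (m + 4) +
        C 2 * X 3 ^ (m + 4) : MvPolynomial (Fin 5) ℂ) =
      (![X 4 ^ (m + 2) * X 1 + C ((m : ℂ) + 4) * X 0 ^ (m + 3),
          X 4 ^ (m + 2) * X 0 + C ((m : ℂ) + 4) * X 1 ^ (m + 3),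
          X 4 ^ (m + 2) * X 3 + C ((m : ℂ) + 4) * X 2 ^ (m + 3),
          X 4 ^ (m + 2) * X 2 + C (2 * ((m : ℂ) + 4)) * X 3 ^ (m + 3),
          C ((m : ℂ) + 2) * X 4 ^ (m + 1) * (X 0 * X 1 + X 2 * X 3)] : Fin 5 → MvPolynomial (Fin 5) ℂ) j := by
  obtain ⟨h0, h1, h2, h3, h4⟩ := pderiv_planeForm m
  fin_cases j
  exacts [h0, h1, h2, h3, h4]

/-- The Hessian of the Π-witness at `e₄` has rank `4`. -/
theorem rank_hessian_planeForm (m : ℕ) :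
    (Matrix.of fun i j : Fin 5 => eval (![0, 0, 0, 0, 1] : Fin 5 → ℂ)
      (pderiv i (pderiv j (X 4 ^ (m + 2) * (X 0 * X 1 + X 2 * X 3) + X 0 ^ (m + 4) + X 1 ^ (m + 4) + X 2 ^ (m + 4) +
        C 2 * X 3 ^ (m + 4) : MvPolynomial (Fin 5) ℂ)))).rank = 4 := by
  have hM : (Matrix.of fun i j : Fin 5 => eval (![0, 0, 0, 0, 1] : Fin 5 → ℂ)
      (pderiv i (pderiv j (X 4 ^ (m + 2) * (X 0 * X 1 + X 2 * X 3) + X 0 ^ (m + 4) + X 1 ^ (m + 4) + X 2 ^ (m + 4) +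
        C 2 * X 3 ^ (m + 4) : MvPolynomial (Fin 5) ℂ)))) =
      !![0, 1, 0, 0, 0; 1, 0, 0, 0, 0; 0, 0, 0, 1, 0; 0, 0, 1, 0, 0; 0, 0, 0, 0, 0] := by
    ext i j
    rw [Matrix.of_apply, pderiv_planeForm_eq m j]
    fin_cases i <;> fin_cases j <;> simp [Derivation.leibniz, Derivation.leibniz_pow, pderiv_X]
  rw [hM]
  refine rank_eq_four (v := ![0, 0, 0, 0, 1]) (A := 1)
    (B := !![0, 1, 0, 0, 0; 1, 0, 0, 0, 0; 0, 0, 0, 1, 0; 0, 0, 1, 0, 0; 0, 0, 0, 0, 0])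
    (w := ![1, 1, 1, 1, 0]) (fun h => by simpa using congr_fun h 4) ?_ ?_ 4 ?_
  · ext i; fin_cases i <;> simp [Matrix.mulVec, dotProduct, Fin.sum_univ_five]
  · ext i j
    fin_cases i <;> fin_cases j <;> simp [Matrix.mul_apply, Fin.sum_univ_five]
  · intro i; fin_cases i <;> simp

/-- **Uniqueness of the singular point of the Π-witness** (the algebraic argument through the split
system): a non-zero `z` at which the gradient vanishes is a multiple of `e₄`. -/
theorem eq_smul_of_grad_planeForm (m : ℕ) (hm : Even m) (z : Fin 5 → ℂ) (hz : z ≠ 0)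
    (hgrad : ∀ j, eval z (pderiv j (X 4 ^ (m + 2) * (X 0 * X 1 + X 2 * X 3) + X 0 ^ (m + 4) + X 1 ^ (m + 4) + X 2 ^ (m + 4) +
        C 2 * X 3 ^ (m + 4) : MvPolynomial (Fin 5) ℂ)) = 0) :
    z = z 4 • (![0, 0, 0, 0, 1] : Fin 5 → ℂ) := by
  have hodd : Odd (m + 3) := hm.add_odd ⟨1, rfl⟩
  have hd : ((m : ℂ) + 4) ≠ 0 := by exact_mod_cast Nat.succ_ne_zero (m + 3)
  have hd2 : ((m : ℂ) + 2) ≠ 0 := by exact_mod_cast Nat.succ_ne_zero (m + 1)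
  have hg : ∀ j, eval z ((![X 4 ^ (m + 2) * X 1 + C ((m : ℂ) + 4) * X 0 ^ (m + 3),
          X 4 ^ (m + 2) * X 0 + C ((m : ℂ) + 4) * X 1 ^ (m + 3),
          X 4 ^ (m + 2) * X 3 + C ((m : ℂ) + 4) * X 2 ^ (m + 3),
          X 4 ^ (m + 2) * X 2 + C (2 * ((m : ℂ) + 4)) * X 3 ^ (m + 3),
          C ((m : ℂ) + 2) * X 4 ^ (m + 1) * (X 0 * X 1 + X 2 * X 3)] : Fin 5 → MvPolynomial (Fin 5) ℂ) j) = 0 :=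
    fun j => by rw [← pderiv_planeForm_eq m j]; exact hgrad j
  have g0 := hg 0
  have g1 := hg 1
  have g2 := hg 2
  have g3 := hg 3
  have g4 := hg 4
  simp only [Matrix.cons_val_zero, Matrix.cons_val_one, Matrix.cons_val_two, Matrix.cons_val_three,
    Matrix.cons_val_four, Matrix.head_cons, Matrix.tail_cons, map_add, map_mul, map_pow, eval_X, eval_C]
    at g0 g1 g2 g3 g4
  by_cases hz4 : z 4 = 0
  · exfalso
    apply hz
    rw [hz4, zero_pow (Nat.succ_ne_zero _), zero_mul, zero_add] at g0 g1 g2 g3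
    have e0 : z 0 = 0 := (pow_eq_zero_iff (Nat.succ_ne_zero _)).1 ((mul_eq_zero.1 g0).resolve_left hd)
    have e1 : z 1 = 0 := (pow_eq_zero_iff (Nat.succ_ne_zero _)).1 ((mul_eq_zero.1 g1).resolve_left hd)
    have e2 : z 2 = 0 := (pow_eq_zero_iff (Nat.succ_ne_zero _)).1 ((mul_eq_zero.1 g2).resolve_left hd)
    have e3 : z 3 = 0 := (pow_eq_zero_iff (Nat.succ_ne_zero _)).1
      ((mul_eq_zero.1 g3).resolve_left (mul_ne_zero two_ne_zero hd))
    funext i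
    fin_cases i <;> simp [e0, e1, e2, e3, hz4]
  · have hw : z 4 ^ (m + 2) ≠ 0 := pow_ne_zero _ hz4
    have hs : z 0 * z 1 + z 2 * z 3 = 0 :=
      (mul_eq_zero.1 g4).resolve_left (mul_ne_zero hd2 (pow_ne_zero _ hz4))
    obtain ⟨e0, e1, e2, e3⟩ := split_pair_eq_zero (α₁ := (1 : ℂ)) (α₂ := 1) (β₁ := 1) (β₂ := 2) hodd hw hd
      (by norm_num) (by rw [mul_one]; exact g0) (by rw [mul_one]; exact g1) (by rw [mul_one]; exact g2)
      (by rw [mul_comm (2 : ℂ) ((m : ℂ) + 4)] at g3; exact g3) hs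
    exact eq_smul_of_apply_eq (by simp [e0]) (by simp [e1]) (by simp [e2]) (by simp [e3]) (by simp)

/-- **The Π-node witness**: for every even `m`, the quinary form
`x₄^{m+2}(x₀x₁ + x₂x₃) + x₀^{m+4} + x₁^{m+4} + x₂^{m+4} + 2x₃^{m+4}` of degree `m + 4` is ι-even and nodal
with the single node `e₄ = [0:0:0:0:1]` (first conjunct of `stub_signNodalForms` at `d = m + 4`). -/
theorem exists_planeNodalForm (m : ℕ) (hm : Even m) :
    ∃ f : MvPolynomial (Fin 5) ℂ, f.IsHomogeneous (m + 4) ∧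
      (∀ e : Fin 5 →₀ ℕ, ¬ Even (e 0 + e 1) → f.coeff e = 0) ∧
      IsNodalFormWithNodes f ![(![0, 0, 0, 0, 1] : Fin 5 → ℂ)] := by
  have hm4 : Even (m + 4) := hm.add ⟨2, rfl⟩
  refine ⟨(X 4 ^ (m + 2) * (X 0 * X 1 + X 2 * X 3) + X 0 ^ (m + 4) + X 1 ^ (m + 4) + X 2 ^ (m + 4) +
        C 2 * X 3 ^ (m + 4) : MvPolynomial (Fin 5) ℂ), ?_, ?_, ?_⟩
  · -- homogeneous of degree `m + 4`
    have hX : ∀ i : Fin 5, (X i : MvPolynomial (Fin 5) ℂ).IsHomogeneous 1 := fun i => isHomogeneous_X ℂ i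
    have hA : (X 4 ^ (m + 2) * (X 0 * X 1 + X 2 * X 3) : MvPolynomial (Fin 5) ℂ).IsHomogeneous (m + 4) := by
      have h := ((hX 4).pow (m + 2)).mul (((hX 0).mul (hX 1)).add ((hX 2).mul (hX 3)))
      rwa [show 1 * (m + 2) + (1 + 1) = m + 4 by ring] at h
    have hB : ∀ i : Fin 5, (X i ^ (m + 4) : MvPolynomial (Fin 5) ℂ).IsHomogeneous (m + 4) := fun i => by
      simpa using (hX i).pow (m + 4)
    have hC : (C 2 * X 3 ^ (m + 4) : MvPolynomial (Fin 5) ℂ).IsHomogeneous (m + 4) := by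
      simpa using (isHomogeneous_C (Fin 5) (2 : ℂ)).mul (hB 3)
    exact (((hA.add (hB 0)).add (hB 1)).add (hB 2)).add hC
  · -- ι-even: the form is fixed by `(x₀, x₁) ↦ (-x₀, -x₁)`
    intro e he
    refine coeff_eq_zero_of_sign_aeval_eq _ ?_ e he
    simp +decide only [map_add, map_mul, map_pow, sign_aeval_X, aeval_C, algebraMap_eq, if_true, if_false,
      map_one, one_mul, map_neg, neg_one_mul, neg_mul_neg, hm4.neg_pow]
  · -- nodal with the single node `e₄`
    refine ⟨fun i => ?_, fun i i' _ => Subsingleton.elim i i', fun z hz hgrad => ⟨0, z 4, ?_⟩⟩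
    · rw [Matrix.cons_val_fin_one]
      refine ⟨fun h => by simpa using congr_fun h 4, fun j => ?_, rank_hessian_planeForm m⟩
      rw [pderiv_planeForm_eq m j]
      fin_cases j <;> simp
    · rw [Matrix.cons_val_fin_one]
      exact eq_smul_of_grad_planeForm m hm z hz hgrad

end Summit.HodgeConjecture.HodgeConjecture.Theorems.SignSymmetricPowersNodalFormPlane

end
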